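import Literature.Probability.Percolation.HalfSpace
import Literature.Probability.Percolation.MeanFieldBetaFromGamma
import Literature.Probability.Percolation.SubgraphMonotonicity
import Literature.Probability.Percolation.ConstrainedClusters
import Literature.Probability.Percolation.SharpnessDCTProofs
import HarnessLib

/-!
# `stub_armToSurfaceTail` — the ambient ↔ induced bridge for the half-space one-arm event

Crux `Summit.CriticalPhenomena.PercolationContinuityZ3.Theses.PercLowPointHalfSpace.QuantitativeBGN`
(item stmt-CriticalPhenomena-0913), line `kl-surface-susceptibility-transfer`, stub
`stub_armToSurfaceTail` (STUB 1 of the line's skeleton).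

Statement proved (for every `p ∈ [0,1]` and every `r : ℕ`):

  `P^{ℤ³}_p({∃ y, (∃ i, r ≤ |y i|) ∧ 0 ↔ y in {x | 0 ≤ x 0}}) ≤ P^{H}_p(|C(halfSpaceOrigin 3)| ≥ r)`,

where the left side is bond percolation on `ℤ³` (`bondPercolation (zdGraph 3) p`) and the right side
is bond percolation on the INDUCED half-space graph `halfSpaceGraph 3 = (zdGraph 3).induce (halfSpace 3)`
with its own Bernoulli measure, `clusterSizeGe x n = {ω | n ≤ |C(x)|}`.

Proof.
* Restriction coupling (`bondPercolation_map_comap`): the push-forward of `P^{ℤ³}_p` under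
  `restrictConfig Subtype.val` is `P^H_p` (`halfSpaceGraph 3 = (zdGraph 3).comap Subtype.val`
  definitionally), so the right side is `P^{ℤ³}_p(restrictConfig val ⁻¹' {|C_H(0)| ≥ r})`
  (`map_measureReal_apply`).
* Inclusion of events for configurations on lattice edges (`DCT16.real_mono_of_forall_subset_edgeSet`):
  an open path inside `H` from `0` to `y` (`DCT16.mem_openConnIn_iff_pathIn`) visits, for every level
  `t < r ≤ |y i|`, a vertex `c_t` with `|c_t i| = t` (first exit from `{|w i| ≤ t}`, lattice steps
  change a coordinate by at most one, `DCT16.abs_sub_le_one_of_adj`), joined to `0` inside `H`; these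
  `r` distinct vertices lie in the open cluster of the origin of the induced graph in the restricted
  configuration (`induce_openGraph_eq`), whence `r ≤ |C_H(0)|`.
-/

noncomputable section

namespace Summit.CriticalPhenomena.PercolationContinuityZ3.Theorems

open MeasureTheory Literature.Probability.Percolation Literature.Probability.LatticeModels

namespace ArmToSurfaceTail

/-- **Discrete intermediate values of one coordinate along an open lattice path.** For a
configuration on lattice edges, an open path inside `A` from `u` to `v` visits, for every level `t`
between `|u i|` and `|v i|`, a vertex `c` with `|c i| = t`, joined to `u` inside `A`. -/
theorem exists_natAbs_apply_eq_of_pathIn {d : ℕ} {ω : BondConfig (Site d)}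
    (hω : ω ⊆ (zdGraph d).edgeSet) {A : Set (Site d)} {u v : Site d}
    (h : PathIn (openGraph ω) A u v) (i : Fin d) {t : ℕ}
    (hu : (u i).natAbs ≤ t) (hv : t ≤ (v i).natAbs) :
    ∃ c, (c i).natAbs = t ∧ PathIn (openGraph ω) A u c := by
  by_cases hvt : (v i).natAbs ≤ t
  · exact ⟨v, le_antisymm hvt hv, h⟩
  · obtain ⟨a, b, ha, hb, -, hab, hpa⟩ := h.exit (R := {w : Site d | (w i).natAbs ≤ t}) hu hvt
    simp only [Set.mem_setOf_eq, not_le] at ha hb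
    have hstep := DCT16.abs_sub_le_one_of_adj (DCT16.adj_of_openGraph_adj hω hab) i
    rw [abs_le] at hstep
    exact ⟨a, by omega, hpa.mono Set.inter_subset_right⟩

/-- **Counting cluster points of the induced half-space graph.** For a configuration on lattice
edges, an open path inside the half-space from `0` to `y` yields, in the restricted configuration on
the induced half-space graph, at least `r` vertices in the open cluster of the origin whenever
`r ≤ |y i|` (one vertex `c_t` with `|c_t i| = t` for each `t < r`). -/
theorem restrictConfig_mem_clusterSizeGe_of_pathIn {d : ℕ} [NeZero d] {ω : BondConfig (Site d)}
    (hω : ω ⊆ (zdGraph d).edgeSet) {y : Site d} (h : PathIn (openGraph ω) (halfSpace d) 0 y)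
    (i : Fin d) {r : ℕ} (hr : r ≤ (y i).natAbs) :
    restrictConfig (Subtype.val : halfSpace d → Site d) ω ∈ clusterSizeGe (halfSpaceOrigin d) r := by
  have hlev : ∀ t : Fin r, ∃ c : halfSpace d, ((c : Site d) i).natAbs = (t : ℕ) ∧
      c ∈ openCluster (restrictConfig (Subtype.val : halfSpace d → Site d) ω) (halfSpaceOrigin d) := by
    intro t
    obtain ⟨c, hc, h0c⟩ := exists_natAbs_apply_eq_of_pathIn hω h i (t := t) (by simp) (t.2.le.trans hr)
    obtain ⟨h0, hcH, hreach⟩ := DCT16.mem_openConnIn_of_pathIn h0c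
    rw [induce_openGraph_eq] at hreach
    exact ⟨⟨c, hcH⟩, hc, hreach⟩
  choose f hf using hlev
  have hinj : Function.Injective f := fun t₁ t₂ h12 =>
    Fin.ext (by rw [← (hf t₁).1, ← (hf t₂).1, h12])
  rw [mem_clusterSizeGe]
  calc (r : ℕ∞) = (Set.range f).encard := by
        rw [← Set.image_univ, hinj.encard_image, Set.encard_univ]; simp
    _ ≤ (openCluster (restrictConfig (Subtype.val : halfSpace d → Site d) ω) (halfSpaceOrigin d)).encard :=
        Set.encard_le_encard (Set.range_subset_iff.2 fun t => (hf t).2)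

end ArmToSurfaceTail

open ArmToSurfaceTail in
/-- **STUB 1 of line `kl-surface-susceptibility-transfer` (`ArmToSurfaceTail`).** For every `p` and
`r`: the half-space one-arm event of bond percolation on `ℤ³`,
`{∃ y, (∃ i, r ≤ |y i|) ∧ 0 ↔ y in {x | 0 ≤ x 0}}`, has `P^{ℤ³}_p`-probability at most the
`P^H_p`-probability that the open cluster of the origin of the INDUCED half-space graph
`halfSpaceGraph 3` has at least `r` vertices. Restriction coupling (`bondPercolation_map_comap`,
`map_measureReal_apply`) plus an almost-sure inclusion of events
(`DCT16.real_mono_of_forall_subset_edgeSet`, `restrictConfig_mem_clusterSizeGe_of_pathIn`). -/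
theorem stub_armToSurfaceTail :
    ∀ (p : unitInterval) (r : ℕ),
      (bondPercolation (zdGraph 3) p).real
          {ω | ∃ y : Site 3, (∃ i : Fin 3, (r : ℤ) ≤ |y i|) ∧
            ω ∈ openConnIn {x : Site 3 | 0 ≤ x 0} 0 y} ≤
        (bondPercolation (halfSpaceGraph 3) p).real (clusterSizeGe (halfSpaceOrigin 3) r) := by
  intro p r
  have hmap : (bondPercolation (zdGraph 3) p).map
      (restrictConfig (Subtype.val : halfSpace 3 → Site 3)) = bondPercolation (halfSpaceGraph 3) p :=
    bondPercolation_map_comap (zdGraph 3) Subtype.val_injective p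
  rw [← hmap, map_measureReal_apply (measurable_restrictConfig _) (measurableSet_clusterSizeGe _ _)]
  refine DCT16.real_mono_of_forall_subset_edgeSet (zdGraph 3) p fun ω hω hA => ?_
  obtain ⟨y, ⟨i, hi⟩, hconn⟩ := hA
  have hr : r ≤ (y i).natAbs := by
    rw [Int.abs_eq_natAbs] at hi
    exact_mod_cast hi
  exact restrictConfig_mem_clusterSizeGe_of_pathIn hω (DCT16.mem_openConnIn_iff_pathIn.1 hconn) i hr

end Summit.CriticalPhenomena.PercolationContinuityZ3.Theorems

end
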